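import Summits.ValiantsHypothesis.ValiantsHypothesis.Theorems.LacunarySymmetroidMatrixDescartesCensusExteriorTangent

/-!
# `MatrixDescartes` census — the EXTERIOR-TANGENT LAW, part III: the SUPPORTING CIRCLE (a dip costs its pole a double root)

HONEST FRAMING.  Object-search cell `pub-symmetroid`, door-A seat `val-sym-door-p1` (g13); helper beside the OPEN typed statements
`DoorA26 = PosRootLawAt 2 6 19` (stmt-ValiantsHypothesis-19979) and `DoorA34` (19980), asserted nowhere.  Companion of
`…CensusExteriorTangent` (the deepest point `x₀` of a return excursion and its exterior tangent line).  Here the law is put in the cell's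
LINEAR currency — the six-nomials `x ↦ tr(W F(x))` of the envelope budget (`…CensusEnvelopeBudget`): at the deepest point the POLE of the
tangent line is the explicit positive-definite matrix

  `W₀ = (tr² F₀ − 2 det F₀)·I − tr F₀ · F₀`,   `F₀ = F(x₀)`   (`det W₀ = −det F₀·(tr²F₀ − 4 det F₀) > 0`, `tr W₀ = tr²F₀ − 4 det F₀ > 0`),

and the function `h(x) = tr(W₀ F(x))` — for a pencil `F = Σ x^{d_l} S_l` a six-nomial with coefficients `tr(W₀ S_l)` — satisfies
(`exteriorTangent_support`, any `C¹` path of real symmetric `2 × 2` matrices, any return gap):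

* `h(x₀) = 0` and `h'(x₀) = 0`: a DOUBLE ROOT at the deepest point (tangency of the curve with its supporting great circle);
* if the excursion is SHALLOW (`tr F(x₀) ≥ 0`, i.e. it does not cross the equator `tr F = 0`), then `h ≥ 0` on the WHOLE gap `[α, β]`
  (the cone «polar angle ≤ that of `F₀`» is convex and `W₀^⊥` supports it along `F₀`; proof: the min clause of `exteriorTangent_gap` plus
  Cauchy–Schwarz);
* `h > 0` at every positive-definite matrix and `h < 0` at every negative-definite one (`trace_posDef_pos`, as `W₀ ≻ 0`).

So in a hypothetical twenty every shallow return excursion between positive-definite gaps COSTS ITS POLE DIRECTION A DOUBLE ROOT inside the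
excursion while `h` stays `≥ 0` there and `> 0` on all positive-definite gaps: with Descartes-with-multiplicity (`≤ 5` roots for a six-nomial)
such an `h` can vanish in at most ONE other excursion between positive-definite gaps (each costs an even number ≥ 2) — the tangency
budget, a sharpening of the envelope budget's «a dip costs a direction two roots» (seat report DOOR-A-P1-REPORT §66; the twenty-level
bookkeeping is not typed here).  Nothing here bounds `ζ_sym(2,6)`/`ζ_sym(3,4)`, decides `DoorA26`/`DoorA34`, or bears on `MatrixDescartes`
(stmt-ValiantsHypothesis-18050) / `VP ≠ VNP`.

[folklore] Supporting plane of a convex circular cone along a boundary ray; Cauchy–Schwarz in `ℝ²`; elementary `2 × 2` positivity.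
-/

-- `Summit.ValiantsHypothesis.ValiantsHypothesis.…` repeats a component by the D-0017 layout
-- (single-conjunct summit), which the `dupNamespace` linter flags; the name is mandated.
set_option linter.dupNamespace false

namespace Summit.ValiantsHypothesis.ValiantsHypothesis.Theorems.LacunarySymmetroidMatrixDescartes.Census

open Set Finset
open scoped BigOperators Topology

/-! ### 1. Positivity of `tr(W F)` for `W, F` definite (`2 × 2`) -/

/-- `tr(W F) > 0` for positive-definite real symmetric `2 × 2` matrices `W = (w₀₀, w₀₁, w₁₁)` and `F = (a, b, c)`:
`w₀₀ a + 2 w₀₁ b + w₁₁ c > 0`. [folklore] -/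
theorem trace_posDef_pos (w₀₀ w₀₁ w₁₁ a b c : ℝ) (hw : 0 < w₀₀) (hW : 0 < w₀₀ * w₁₁ - w₀₁ ^ 2)
    (ha : 0 < a) (hF : 0 < a * c - b ^ 2) : 0 < w₀₀ * a + 2 * w₀₁ * b + w₁₁ * c := by
  have hw11 : 0 < w₁₁ := by nlinarith [sq_nonneg w₀₁]
  have hc : 0 < c := by nlinarith [sq_nonneg b]
  have h1 : 0 < w₀₀ * a := mul_pos hw ha
  have h2 : 0 < w₁₁ * c := mul_pos hw11 hc
  -- (w₀₁ b)² < (w₀₀ a)(w₁₁ c)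
  have h3 : (w₀₁ * b) ^ 2 < (w₀₀ * a) * (w₁₁ * c) := by
    have h4 : w₀₁ ^ 2 * b ^ 2 ≤ w₀₁ ^ 2 * (a * c) :=
      mul_le_mul_of_nonneg_left (by linarith) (sq_nonneg w₀₁)
    have h5 : w₀₁ ^ 2 * (a * c) < (w₀₀ * w₁₁) * (a * c) :=
      mul_lt_mul_of_pos_right (by linarith) (mul_pos ha hc)
    nlinarith [h4, h5]
  nlinarith [sq_nonneg (w₀₀ * a - w₁₁ * c), h1, h2, h3, sq_nonneg (w₀₀ * a + w₁₁ * c + 2 * w₀₁ * b)]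

/-- `tr(W F) < 0` for `W` positive-definite and `F` NEGATIVE-definite (`a < 0 < a c − b²`). [folklore] -/
theorem trace_posDef_negDef_neg (w₀₀ w₀₁ w₁₁ a b c : ℝ) (hw : 0 < w₀₀) (hW : 0 < w₀₀ * w₁₁ - w₀₁ ^ 2)
    (ha : a < 0) (hF : 0 < a * c - b ^ 2) : w₀₀ * a + 2 * w₀₁ * b + w₁₁ * c < 0 := by
  have h := trace_posDef_pos w₀₀ w₀₁ w₁₁ (-a) (-b) (-c) hw hW (by linarith) (by nlinarith)
  linarith

/-! ### 2. The pole at a critical point: algebra -/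

/-- The pole matrix `W₀ = (T₀² − 2f₀) I − T₀ F₀` of `F₀ = (a, b, c)` (`T₀ = a + c`, `f₀ = a c − b²`) is positive definite as soon as `f₀ < 0`:
`(W₀)₀₀ > 0` and `det W₀ = −f₀ (T₀² − 4 f₀) > 0`. [folklore] -/
theorem pole_posDef (a b c : ℝ) (hf : a * c - b ^ 2 < 0) :
    0 < ((a + c) ^ 2 - 2 * (a * c - b ^ 2) - (a + c) * a) ∧
    0 < ((a + c) ^ 2 - 2 * (a * c - b ^ 2) - (a + c) * a) * ((a + c) ^ 2 - 2 * (a * c - b ^ 2) - (a + c) * c)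
        - (-((a + c) * b)) ^ 2 := by
  constructor
  · -- (W₀)₀₀ = c² + 2b² − a c + ... : = b² + c² + (b² − a c) + ... ; write it as a sum of a square and −f₀
    nlinarith [sq_nonneg c, sq_nonneg b]
  · have e : ((a + c) ^ 2 - 2 * (a * c - b ^ 2) - (a + c) * a) * ((a + c) ^ 2 - 2 * (a * c - b ^ 2) - (a + c) * c)
        - (-((a + c) * b)) ^ 2 = -(a * c - b ^ 2) * ((a + c) ^ 2 - 4 * (a * c - b ^ 2)) := by ring
    rw [e]
    have h2 : 0 < (a + c) ^ 2 - 4 * (a * c - b ^ 2) := by nlinarith [sq_nonneg (a + c)]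
    nlinarith

/-- The pole functional vanishes at `F₀` itself: `tr(W₀ F₀) = 0`. [folklore] -/
theorem pole_self (a b c : ℝ) :
    ((a + c) ^ 2 - 2 * (a * c - b ^ 2) - (a + c) * a) * a + 2 * (-((a + c) * b)) * b
      + ((a + c) ^ 2 - 2 * (a * c - b ^ 2) - (a + c) * c) * c = 0 := by
  ring

/-- At a critical point of the polar cosine (`T₀ f' = 2 f₀ T'`) the pole functional also kills the derivative: `tr(W₀ F₀') = 0`. [folklore] -/
theorem pole_deriv (a b c a' b' c' : ℝ)
    (hcrit : (a + c) * (a' * c + a * c' - 2 * b * b') = 2 * (a * c - b ^ 2) * (a' + c')) :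
    ((a + c) ^ 2 - 2 * (a * c - b ^ 2) - (a + c) * a) * a' + 2 * (-((a + c) * b)) * b'
      + ((a + c) ^ 2 - 2 * (a * c - b ^ 2) - (a + c) * c) * c' = 0 := by
  linear_combination hcrit

/-- SUPPORT INEQUALITY (algebra).  If `F₀ = (a₀,b₀,c₀)` is indefinite with `tr F₀ ≥ 0`, and `F = (a,b,c)` is at most as deep as `F₀` in the
sense of the min clause — `tr F₀ · √(tr²F − 4 det F) ≤ tr F · √(tr²F₀ − 4 det F₀)` — then `tr(W₀ F) ≥ 0`. [folklore] -/
theorem pole_nonneg_of_depth (a₀ b₀ c₀ a b c : ℝ) (hf₀ : a₀ * c₀ - b₀ ^ 2 < 0) (hT₀ : 0 ≤ a₀ + c₀)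
    (hdepth : (a₀ + c₀) * Real.sqrt ((a + c) ^ 2 - 4 * (a * c - b ^ 2))
      ≤ (a + c) * Real.sqrt ((a₀ + c₀) ^ 2 - 4 * (a₀ * c₀ - b₀ ^ 2))) :
    0 ≤ ((a₀ + c₀) ^ 2 - 2 * (a₀ * c₀ - b₀ ^ 2) - (a₀ + c₀) * a₀) * a + 2 * (-((a₀ + c₀) * b₀)) * b
      + ((a₀ + c₀) ^ 2 - 2 * (a₀ * c₀ - b₀ ^ 2) - (a₀ + c₀) * c₀) * c := by
  obtain ⟨R₀, hR₀⟩ : ∃ R₀ : ℝ, R₀ = (a₀ + c₀) ^ 2 - 4 * (a₀ * c₀ - b₀ ^ 2) := ⟨_, rfl⟩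
  obtain ⟨R, hR⟩ : ∃ R : ℝ, R = (a + c) ^ 2 - 4 * (a * c - b ^ 2) := ⟨_, rfl⟩
  rw [← hR₀, ← hR] at hdepth
  have hR₀' : R₀ = (a₀ - c₀) ^ 2 + (2 * b₀) ^ 2 := by rw [hR₀]; ring
  have hR' : R = (a - c) ^ 2 + (2 * b) ^ 2 := by rw [hR]; ring
  have hR₀pos : 0 < R₀ := by rw [hR₀]; nlinarith [sq_nonneg (a₀ + c₀)]
  have hRnn : 0 ≤ R := by rw [hR']; positivity
  obtain ⟨s₀, hs₀⟩ : ∃ s₀ : ℝ, s₀ = Real.sqrt R₀ := ⟨_, rfl⟩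
  obtain ⟨s, hs⟩ : ∃ s : ℝ, s = Real.sqrt R := ⟨_, rfl⟩
  rw [← hs₀, ← hs] at hdepth
  have hs₀pos : 0 < s₀ := by rw [hs₀]; exact Real.sqrt_pos.2 hR₀pos
  have hsnn : 0 ≤ s := by rw [hs]; exact Real.sqrt_nonneg _
  have hs₀sq : s₀ ^ 2 = R₀ := by rw [hs₀]; exact Real.sq_sqrt hR₀pos.le
  have hssq : s ^ 2 = R := by rw [hs]; exact Real.sq_sqrt hRnn
  -- Cauchy–Schwarz in ℝ²: (a₀ − c₀)(a − c) + (2b₀)(2b) ≤ s₀ s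
  have hCS : (a₀ - c₀) * (a - c) + 4 * b₀ * b ≤ s₀ * s := by
    have hprod : 0 ≤ s₀ * s := mul_nonneg hs₀pos.le hsnn
    have hsq : ((a₀ - c₀) * (a - c) + 4 * b₀ * b) ^ 2 ≤ (s₀ * s) ^ 2 := by
      have e : (s₀ * s) ^ 2 = ((a₀ - c₀) ^ 2 + (2 * b₀) ^ 2) * ((a - c) ^ 2 + (2 * b) ^ 2) := by
        rw [mul_pow, hs₀sq, hssq, hR₀', hR']
      rw [e]
      nlinarith [sq_nonneg ((a₀ - c₀) * (2 * b) - (2 * b₀) * (a - c))]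
    exact (le_abs_self _).trans (abs_le_of_sq_le_sq hsq hprod)
  -- 2·tr(W₀ F) = R₀·tr F − tr F₀·[(a₀−c₀)(a−c) + 4 b₀ b] ≥ R₀ tr F − tr F₀ · s₀ s = s₀ (s₀ tr F − tr F₀ · s) ≥ 0
  have e2 : 2 * (((a₀ + c₀) ^ 2 - 2 * (a₀ * c₀ - b₀ ^ 2) - (a₀ + c₀) * a₀) * a + 2 * (-((a₀ + c₀) * b₀)) * b
      + ((a₀ + c₀) ^ 2 - 2 * (a₀ * c₀ - b₀ ^ 2) - (a₀ + c₀) * c₀) * c)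
      = R₀ * (a + c) - (a₀ + c₀) * ((a₀ - c₀) * (a - c) + 4 * b₀ * b) := by
    rw [hR₀]; ring
  have h1 : (a₀ + c₀) * ((a₀ - c₀) * (a - c) + 4 * b₀ * b) ≤ (a₀ + c₀) * (s₀ * s) :=
    mul_le_mul_of_nonneg_left hCS hT₀
  have h3 : R₀ * (a + c) - (a₀ + c₀) * (s₀ * s) = s₀ * (s₀ * (a + c) - (a₀ + c₀) * s) := by
    rw [← hs₀sq]; ring
  have h4 : 0 ≤ s₀ * (s₀ * (a + c) - (a₀ + c₀) * s) :=
    mul_nonneg hs₀pos.le (by nlinarith [hdepth])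
  nlinarith [e2, h1, h3, h4]

/-! ### 3. The supporting circle on a gap -/

/-- **SUPPORTING-CIRCLE THEOREM.**  Let `a, b, c : ℝ → ℝ` be differentiable (entries of a symmetric `2 × 2` path `F`, derivatives `a', b', c'`)
and let `(α, β)` be a return excursion between positive-definite gaps (`det F(α) = det F(β) = 0`, `det F < 0` inside, `tr F(α), tr F(β) > 0`).
Then there is `x₀ ∈ (α, β)` (the deepest point) such that, with `F₀ = F(x₀)` and the POLE `W₀ = (tr²F₀ − 2 det F₀) I − tr F₀·F₀`
(entries `w₀₀, w₀₁, w₁₁` below) and `h(x) = w₀₀ a(x) + 2 w₀₁ b(x) + w₁₁ c(x) = tr(W₀ F(x))`: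
(i) `W₀ ≻ 0`; (ii) `h(x₀) = 0`; (iii) `h'(x₀) = 0` (double root); (iv) if the excursion is shallow, `tr F(x₀) ≥ 0`, then `h ≥ 0` on `[α, β]`;
(v) `h > 0` at every positive-definite `F(y)` and `h < 0` at every negative-definite `F(y)`. [folklore] -/
theorem exteriorTangent_support {a b c a' b' c' : ℝ → ℝ}
    (ha : ∀ x, HasDerivAt a (a' x) x) (hb : ∀ x, HasDerivAt b (b' x) x) (hc : ∀ x, HasDerivAt c (c' x) x)
    {α β : ℝ} (hαβ : α < β)
    (hfα : a α * c α - b α ^ 2 = 0) (hfβ : a β * c β - b β ^ 2 = 0)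
    (hneg : ∀ x ∈ Ioo α β, a x * c x - b x ^ 2 < 0)
    (hTα : 0 < a α + c α) (hTβ : 0 < a β + c β) :
    ∃ x₀ ∈ Ioo α β, ∃ w₀₀ w₀₁ w₁₁ : ℝ,
      w₀₀ = (a x₀ + c x₀) ^ 2 - 2 * (a x₀ * c x₀ - b x₀ ^ 2) - (a x₀ + c x₀) * a x₀ ∧
      w₀₁ = -((a x₀ + c x₀) * b x₀) ∧
      w₁₁ = (a x₀ + c x₀) ^ 2 - 2 * (a x₀ * c x₀ - b x₀ ^ 2) - (a x₀ + c x₀) * c x₀ ∧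
      (0 < w₀₀ ∧ 0 < w₀₀ * w₁₁ - w₀₁ ^ 2) ∧
      w₀₀ * a x₀ + 2 * w₀₁ * b x₀ + w₁₁ * c x₀ = 0 ∧
      w₀₀ * a' x₀ + 2 * w₀₁ * b' x₀ + w₁₁ * c' x₀ = 0 ∧
      (0 ≤ a x₀ + c x₀ → ∀ x ∈ Icc α β, 0 ≤ w₀₀ * a x + 2 * w₀₁ * b x + w₁₁ * c x) ∧
      (∀ y, 0 < a y → 0 < a y * c y - b y ^ 2 → 0 < w₀₀ * a y + 2 * w₀₁ * b y + w₁₁ * c y) ∧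
      (∀ y, a y < 0 → 0 < a y * c y - b y ^ 2 → w₀₀ * a y + 2 * w₀₁ * b y + w₁₁ * c y < 0) := by
  obtain ⟨x₀, hx₀, hmin, hcrit⟩ := exteriorTangent_gap ha hb hc hαβ hfα hfβ hneg hTα hTβ
  have hf₀ := hneg x₀ hx₀
  have hW := pole_posDef (a x₀) (b x₀) (c x₀) hf₀
  refine ⟨x₀, hx₀, _, _, _, rfl, rfl, rfl, hW, pole_self _ _ _, pole_deriv _ _ _ _ _ _ hcrit, ?_,
    fun y hya hyf => trace_posDef_pos _ _ _ _ _ _ hW.1 hW.2 hya hyf,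
    fun y hya hyf => trace_posDef_negDef_neg _ _ _ _ _ _ hW.1 hW.2 hya hyf⟩
  intro hT₀ x hx
  -- the radicands are positive on the closed gap, so the min clause can be cross-multiplied
  have hRpos : ∀ y ∈ Icc α β, 0 < (a y + c y) ^ 2 - 4 * (a y * c y - b y ^ 2) := by
    intro y hy
    by_cases hyα : y = α
    · subst hyα; rw [hfα]; nlinarith
    by_cases hyβ : y = β
    · subst hyβ; rw [hfβ]; nlinarith
    have hy' : y ∈ Ioo α β := ⟨lt_of_le_of_ne hy.1 (Ne.symm hyα), lt_of_le_of_ne hy.2 hyβ⟩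
    have := hneg y hy'
    nlinarith [sq_nonneg (a y + c y)]
  have hx₀I : x₀ ∈ Icc α β := Ioo_subset_Icc_self hx₀
  have hs₀ : 0 < Real.sqrt ((a x₀ + c x₀) ^ 2 - 4 * (a x₀ * c x₀ - b x₀ ^ 2)) := Real.sqrt_pos.2 (hRpos x₀ hx₀I)
  have hs : 0 < Real.sqrt ((a x + c x) ^ 2 - 4 * (a x * c x - b x ^ 2)) := Real.sqrt_pos.2 (hRpos x hx)
  have hdepth : (a x₀ + c x₀) * Real.sqrt ((a x + c x) ^ 2 - 4 * (a x * c x - b x ^ 2))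
      ≤ (a x + c x) * Real.sqrt ((a x₀ + c x₀) ^ 2 - 4 * (a x₀ * c x₀ - b x₀ ^ 2)) := by
    have h := hmin x hx
    rw [div_le_div_iff₀ hs₀ hs] at h
    exact h
  exact pole_nonneg_of_depth _ _ _ _ _ _ hf₀ hT₀ hdepth

end Summit.ValiantsHypothesis.ValiantsHypothesis.Theorems.LacunarySymmetroidMatrixDescartes.Census
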